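import Summits.BirchSwinnertonDyer.BirchSwinnertonDyer.Theorems.ByReductionTypeAtTwoRankOneAtTwoOffBigImageOddLocalEngineChiKernelAtTwo
import Mathlib.LinearAlgebra.FreeModule.Finite.CardQuotient
import HarnessLib

/-!
# Route `ByReductionTypeAtTwo`, crux `RankOneAtTwoOffBigImageOddLocal` (stmt-BirchSwinnertonDyer-23716), line
# `refined_kolyvagin_tamagawa_shift_at_two` — ENGINE PORT, card E4-γ: the REGULAR RELATION LATTICE from cyclicity + cardinality

Lead prover `prover-cruxlead-stmt-BirchSwinnertonDyer-23716-g2` (2026-08-28).  `…EngineChiKernelAtTwo` §2 / `…EngineKolyvaginRelationRegular` take the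
regular structure of `C = Ẽ(𝔽_{ℓ²})[2^∞]` in the form «`ℤ[φ]`-generator `g` whose RELATION LATTICE is the odd saturation of
`L₀ = ⟨(2^M l', -2^M a'), (-2^M a', 2^M l')⟩`» (`hrel`).  This file derives `hrel` from the two facts a geometric consumer actually has:
CYCLICITY (`C = ℤ g + ℤ φ g`, i.e. `Frob(ℓ)` regular) and the CARDINALITY `#C = 2^{2M + v}` with `2^v ∥ l'² - a'²`
(`#Ẽ(𝔽_{ℓ²}) = (ℓ + 1 - a_ℓ)(ℓ + 1 + a_ℓ) = 2^{2M}(l'² - a'²)`).  Proof: the relation lattice `L = ker(ℤ² → C)` has index `#C = 2^{2M+v}`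
(first isomorphism theorem); `L₀ ≤ L` (characteristic relation at `g`, `φ g`) has index `|det| = 2^{2M} |l'² - a'²| = 2^{2M+v} |d|` in `ℤ²`
(Mathlib `AddSubgroup.index_eq_natAbs_det`); hence `[L : L₀] = |d|` is ODD and `|d| • L ⊆ L₀` (`AddSubgroup.nsmul_relIndex_mem`).

* `KolyvaginChiTwo.relations_of_card` — `hrel` from `hgen` + `Nat.card C = 2 ^ (2 * M + v)` + `l'² - a'² = 2^v d`, `d` odd.

Pure algebra; nothing here proves the crux, `BSDp W 2`, BSD or the summit; no registered stub is discharged.  BSD is not proved.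

Refs: [McCallumLMS1991] §4 Prop. 4.4 (2) («cyclic of order `l + 1 - Frob(l) a_l`»).
-/

set_option linter.dupNamespace false -- tree convention: `Summit.BirchSwinnertonDyer.BirchSwinnertonDyer.Theorems` (summit = sub-problem)
set_option autoImplicit false

noncomputable section

namespace Summit.BirchSwinnertonDyer.BirchSwinnertonDyer.Theorems.OffBigImageOddLocalAtTwo.Engine

namespace KolyvaginChiTwo

open Module

variable {C : Type*} [AddCommGroup C]

/-- **The regular relation lattice from cyclicity and cardinality.**  `φ` an additive involution of `C` with the characteristic relation
`(2^M l') c = (2^M a') φ(c)`; `C = ℤ g + ℤ φ g` (`ℤ[φ]`-CYCLIC — regular Frobenius); `#C = 2^{2M+v}` where `l'² - a'² = 2^v d` with `d` odd.  Then the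
relations of `(g, φ g)` are the odd saturation of `⟨(2^M l', -2^M a'), (-2^M a', 2^M l')⟩`: `i g + j φ g = 0 ⇒ ∃ k odd, x, y` with
`k i = 2^M (l' x - a' y)`, `k j = 2^M (l' y - a' x)` (in fact `k = |d|`). [folklore] -/
theorem relations_of_card [Finite C] (φ : C →+ C) (hφ : ∀ c, φ (φ c) = c) {M v : ℕ} {a' l' d : ℤ} (hd : Odd d)
    (hN : l' ^ 2 - a' ^ 2 = 2 ^ v * d) (hchar : ∀ c : C, ((2 : ℤ) ^ M * l') • c = ((2 : ℤ) ^ M * a') • φ c)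
    {g : C} (hgen : ∀ c : C, ∃ i j : ℤ, c = i • g + j • φ g) (hcard : Nat.card C = 2 ^ (2 * M + v))
    (i j : ℤ) (hij : i • g + j • φ g = 0) :
    ∃ k x y : ℤ, Odd k ∧ k * i = 2 ^ M * (l' * x - a' * y) ∧ k * j = 2 ^ M * (l' * y - a' * x) := by
  classical
  -- the presentation `Ψ : ℤ² → C`
  set Ψ : (Fin 2 → ℤ) →+ C := AddMonoidHom.mk' (fun u ↦ u 0 • g + u 1 • φ g)
    (fun u w ↦ by simp only [Pi.add_apply, add_zsmul]; abel) with hΨdef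
  have hΨ : ∀ u : Fin 2 → ℤ, Ψ u = u 0 • g + u 1 • φ g := fun u ↦ rfl
  have hΨsurj : Function.Surjective Ψ := fun c ↦ by
    obtain ⟨i', j', rfl⟩ := hgen c
    exact ⟨![i', j'], by simp [hΨ]⟩
  set L : AddSubgroup (Fin 2 → ℤ) := Ψ.ker with hLdef
  have hLindex : L.index = 2 ^ (2 * M + v) := by
    rw [hLdef, AddSubgroup.index_ker, AddMonoidHom.range_eq_top.mpr hΨsurj, AddSubgroup.card_top, hcard]
  -- the two characteristic relations
  set v₁ : Fin 2 → ℤ := ![(2 : ℤ) ^ M * l', -((2 : ℤ) ^ M * a')] with hv₁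
  set v₂ : Fin 2 → ℤ := ![-((2 : ℤ) ^ M * a'), (2 : ℤ) ^ M * l'] with hv₂
  have hv₁L : v₁ ∈ L := by
    rw [hLdef, AddMonoidHom.mem_ker, hΨ]
    simp only [hv₁, Matrix.cons_val_zero, Matrix.cons_val_one, neg_zsmul]
    rw [hchar g, ← sub_eq_add_neg, sub_self]
  have hv₂L : v₂ ∈ L := by
    rw [hLdef, AddMonoidHom.mem_ker, hΨ]
    simp only [hv₂, Matrix.cons_val_zero, Matrix.cons_val_one, neg_zsmul]
    have h := hchar (φ g)
    rw [hφ] at h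
    rw [h, neg_add_cancel]
  set L₀ : AddSubgroup (Fin 2 → ℤ) := AddSubgroup.closure {v₁, v₂} with hL₀def
  have hL₀L : L₀ ≤ L := by
    rw [hL₀def, AddSubgroup.closure_le]
    rintro u (rfl | rfl)
    · exact hv₁L
    · exact hv₂L
  have hv₁mem : v₁ ∈ L₀ := AddSubgroup.subset_closure (by simp)
  have hv₂mem : v₂ ∈ L₀ := AddSubgroup.subset_closure (by simp)
  -- nondegeneracy
  have h2M : (2 : ℤ) ^ M ≠ 0 := pow_ne_zero _ two_ne_zero
  have hd0 : d ≠ 0 := by rintro rfl; exact (Int.not_even_iff_odd.mpr hd) (by decide)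
  have hNne : l' ^ 2 - a' ^ 2 ≠ 0 := by rw [hN]; exact mul_ne_zero (pow_ne_zero _ two_ne_zero) hd0
  -- a `ℤ`-basis of `L₀`
  have hcoord : ∀ (s t : ℤ) (w : L₀), (s • (⟨v₁, hv₁mem⟩ : L₀) + t • (⟨v₂, hv₂mem⟩ : L₀) : L₀) = w →
      (s * ((2 : ℤ) ^ M * l') + t * (-((2 : ℤ) ^ M * a')) = (w : Fin 2 → ℤ) 0 ∧
       s * (-((2 : ℤ) ^ M * a')) + t * ((2 : ℤ) ^ M * l') = (w : Fin 2 → ℤ) 1) := fun s t w h ↦ by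
    have h' := congrArg Subtype.val h
    simp only [AddSubgroup.coe_add, AddSubgroupClass.coe_zsmul] at h'
    constructor
    · have := congrFun h' 0
      simpa [hv₁, hv₂] using this
    · have := congrFun h' 1
      simpa [hv₁, hv₂] using this
  have hli : LinearIndependent ℤ ![(⟨v₁, hv₁mem⟩ : L₀), ⟨v₂, hv₂mem⟩] := by
    rw [LinearIndependent.pair_iff]
    intro s t hst
    obtain ⟨h0, h1⟩ := hcoord s t 0 hst
    simp only [ZeroMemClass.coe_zero, Pi.zero_apply] at h0 h1
    have hs : (l' ^ 2 - a' ^ 2) * ((2 : ℤ) ^ M * s) = 0 := by linear_combination l' * h0 + a' * h1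
    have ht : (l' ^ 2 - a' ^ 2) * ((2 : ℤ) ^ M * t) = 0 := by linear_combination a' * h0 + l' * h1
    rcases mul_eq_zero.mp hs with h | h
    · exact absurd h hNne
    rcases mul_eq_zero.mp ht with h' | h'
    · exact absurd h' hNne
    exact ⟨(mul_eq_zero.mp h).resolve_left h2M, (mul_eq_zero.mp h').resolve_left h2M⟩
  have hsp : ⊤ ≤ Submodule.span ℤ (Set.range ![(⟨v₁, hv₁mem⟩ : L₀), ⟨v₂, hv₂mem⟩]) := by
    rintro w -
    obtain ⟨m, n, hmn⟩ := AddSubgroup.mem_closure_pair.mp w.2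
    have hw : w = m • (⟨v₁, hv₁mem⟩ : L₀) + n • ⟨v₂, hv₂mem⟩ :=
      Subtype.ext (by simp only [AddSubgroup.coe_add, AddSubgroupClass.coe_zsmul]; exact hmn.symm)
    rw [hw]
    refine Submodule.add_mem _ (Submodule.smul_mem _ _ (Submodule.subset_span ⟨0, rfl⟩))
      (Submodule.smul_mem _ _ (Submodule.subset_span ⟨1, rfl⟩))
  set bN : Basis (Fin 2) ℤ L₀ := Basis.mk hli hsp with hbN
  have hbN : ∀ i, (bN i : Fin 2 → ℤ) = ![v₁, v₂] i := fun i ↦ by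
    rw [Basis.mk_apply]; fin_cases i <;> rfl
  -- index of `L₀` in `ℤ²` = `|det|`
  have hL₀index : L₀.index = (2 ^ (2 * M + v)) * d.natAbs := by
    rw [AddSubgroup.index_eq_natAbs_det (Pi.basisFun ℤ (Fin 2)) L₀ bN, Pi.basisFun_det_apply, Matrix.det_fin_two]
    simp only [Matrix.of_apply, hbN, hv₁, hv₂, Matrix.cons_val_zero, Matrix.cons_val_one]
    rw [show (2 : ℤ) ^ M * l' * ((2 : ℤ) ^ M * l') - -((2 : ℤ) ^ M * a') * -((2 : ℤ) ^ M * a') =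
        (2 : ℤ) ^ (2 * M + v) * d by
      rw [pow_add, pow_mul, show ((2 : ℤ) ^ 2) ^ M = (2 : ℤ) ^ M * (2 : ℤ) ^ M by rw [← pow_mul, ← pow_add]; ring_nf]
      linear_combination (2 : ℤ) ^ M * (2 : ℤ) ^ M * hN]
    rw [Int.natAbs_mul, Int.natAbs_pow]
    rfl
  -- the relative index is `|d|`, odd
  have hrel : L₀.relIndex L = d.natAbs := by
    have h := AddSubgroup.relIndex_mul_index hL₀L
    rw [hLindex, hL₀index, mul_comm (2 ^ (2 * M + v))] at h
    exact Nat.eq_of_mul_eq_mul_right (pow_pos (by norm_num) _) h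
  -- `|d| • (i, j) ∈ L₀`
  have hu : (![i, j] : Fin 2 → ℤ) ∈ L := by
    rw [hLdef, AddMonoidHom.mem_ker, hΨ]
    simpa using hij
  have hdu : (d.natAbs : ℕ) • (![i, j] : Fin 2 → ℤ) ∈ L₀ := by
    rw [← hrel]; exact AddSubgroup.nsmul_relIndex_mem L₀ hu
  obtain ⟨x, y, hxy⟩ := AddSubgroup.mem_closure_pair.mp hdu
  refine ⟨d.natAbs, x, y, ?_, ?_, ?_⟩
  · exact Int.natAbs_odd.mpr hd |> fun h ↦ by exact_mod_cast h
  · have h0 := congrFun hxy 0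
    simp only [hv₁, hv₂, Pi.add_apply, Pi.smul_apply, smul_eq_mul, nsmul_eq_mul, Matrix.cons_val_zero] at h0
    linear_combination -h0
  · have h1 := congrFun hxy 1
    simp only [hv₁, hv₂, Pi.add_apply, Pi.smul_apply, smul_eq_mul, nsmul_eq_mul, Matrix.cons_val_one,
      Matrix.cons_val_fin_one] at h1
    linear_combination -h1

end KolyvaginChiTwo

end Summit.BirchSwinnertonDyer.BirchSwinnertonDyer.Theorems.OffBigImageOddLocalAtTwo.Engine

end
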